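import Summits.ValiantsHypothesis.ValiantsHypothesis.Theorems.ClassTransfer.Negative.CoverBalance

/-!
# Crux `ClassTransfer` (stmt-ValiantsHypothesis-7287), negative side — cover-balance tests at
# family level, and the odd-cycle cover polynomial

Lead prover (gen 1) of line `registered`; companion of `Negative/CoverBalance.lean`, which proves
the single-size statements `K₂(w) ≠ 0 ⇒ per_m ≤_proj d_w` (`S_{m+m}`) and
`K₃(w) ≠ 0 ⇒ per_m ≤_proj d_w` (`S_{3m}`) for arbitrary class functions `w`.  Here:

* `isProjection_perPoly_of_le` — `per_m ≤_proj per_{m'}` for `m ≤ m'` (iterate the tree's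
  `isProjection_perPoly_succ`), so a test that fires only from some `m₀` on still gives a
  p-projection;
* `isPProjection_perPoly_classGMF_two/three`, `VP_eq_VNP_of_isVPFamily_classGMF_two/three` —
  **if a class-function family `χ` has `K₂(χ_{2m}) ≠ 0` (resp. `K₃(χ_{3m}) ≠ 0`) for all
  `m ≥ m₀`, then the permanent family is a p-projection of its GMF family
  `n ↦ Σ_σ χ_n(σ) ∏ x_{σ(i),i}`, hence `IsVPFamily (GMF χ) → VP = VNP`;**
* `classGMF_two/three_balanced_io_of_valiantsHypothesis` — contrapositive: under
  `ValiantsHypothesis`, a `VP` class-function family is 2-balanced and 3-balanced for infinitely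
  many `m` (`∀ m₀ ∃ m ≥ m₀, K = 0`);
* `VP_eq_VNP_of_isVPFamily_oddOrderCover` — the odd-cycle cover polynomial
  `O_n = Σ_{σ ∈ S_n of odd order} x^σ` (all cycles odd; these `σ` are even, so `O_n` is also the
  "odd-cycle determinant" `Σ_{all cycles odd} sgn σ x^σ`, the twin of `D^even`) is permanent-hard:
  `3·δ` has odd order iff `δ` has, so `K₃ = #{δ ∈ S_m of odd order} ≥ 1`.

No definitions. [folklore]
-/

set_option linter.dupNamespace false

noncomputable section

namespace Summit.ValiantsHypothesis.ValiantsHypothesis.Theorems.ClassTransfer.Negative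

open Equiv Finset
open Literature.Computability.AlgebraicComplexity
open scoped Fin.NatCast

/-- `per_m` is a projection of `per_{m'}` whenever `m ≤ m'` (iterate `per_m ≤ per_{m+1}`).
[folklore] -/
theorem isProjection_perPoly_of_le (k : Type*) [CommRing k] {m m' : ℕ} (h : m ≤ m') :
    IsProjection (perPoly (Fin m) k) (perPoly (Fin m') k) := by
  induction h with
  | refl => exact IsProjection.refl _
  | step _ ih =>
    exact IsProjection.trans_holds ih
      (Summit.ValiantsHypothesis.Theorems.DetqpThesis.Negative.isProjection_perPoly_succ k _)

/-! ## Two-fold test, family level -/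

/-- **Two-fold cover test for families.**  If `χ` is a class-function family whose two-fold
balance constants `K₂(χ_{m+m}) = Σ_δ χ_{m+m}(inl i ↦ inr i, inr j ↦ inl (δ j))` are nonzero for
all `m ≥ m₀`, then the permanent family is a p-projection of the GMF family of `χ`
(sizes `2 · max(m, m₀, 1)`). [folklore] -/
theorem isPProjection_perPoly_classGMF_two (χ : (n : ℕ) → Perm (Fin n) → ℂ)
    (hχ : ∀ n (σ τ : Perm (Fin n)), IsConj σ τ → χ n σ = χ n τ) (m₀ : ℕ)
    (hK : ∀ m : ℕ, m₀ ≤ m → 0 < m → ∑ δ : Perm (Fin m), χ (m + m) (finSumFinEquiv.permCongr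
      ((Equiv.sumCongr (1 : Perm (Fin m)) δ).trans (Equiv.sumComm (Fin m) (Fin m)))) ≠ 0) :
    IsPProjection (fun m => perPoly (Fin m) ℂ)
      (fun n => ∑ σ : Perm (Fin n),
        MvPolynomial.C (χ n σ) * ∏ i : Fin n, MvPolynomial.X (σ i, i)) := by
  refine ⟨fun m => max m (max m₀ 1) + max m (max m₀ 1),
    (IsPBounded.iff_exists_le_mul_succ_pow _).2 ⟨2 * m₀ + 2, 1, fun n => ?_⟩, fun m => ?_⟩
  · have h1 : max n (max m₀ 1) ≤ n + m₀ + 1 := by omega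
    have h2 : (2 * m₀ + 2) * (n + 1) ^ 1 = 2 * (m₀ * n) + 2 * m₀ + 2 * n + 2 := by ring
    omega
  dsimp only
  set M := max m (max m₀ 1) with hM
  have hmM : m ≤ M := le_max_left _ _
  have hM0 : m₀ ≤ M := (le_max_left _ _).trans (le_max_right _ _)
  have hM1 : 0 < M := Nat.lt_of_lt_of_le Nat.one_pos ((le_max_right _ _).trans (le_max_right _ _))
  exact IsProjection.trans_holds (isProjection_perPoly_of_le ℂ hmM)
    (isProjection_perPoly_classGMF_two M hM1 (χ (M + M)) (hχ _) (hK M hM0 hM1))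

/-- **`K₂ ≠ 0` eventually and GMF family in `VP` force `VP = VNP`.** [folklore] -/
theorem VP_eq_VNP_of_isVPFamily_classGMF_two (χ : (n : ℕ) → Perm (Fin n) → ℂ)
    (hχ : ∀ n (σ τ : Perm (Fin n)), IsConj σ τ → χ n σ = χ n τ) (m₀ : ℕ)
    (hK : ∀ m : ℕ, m₀ ≤ m → 0 < m → ∑ δ : Perm (Fin m), χ (m + m) (finSumFinEquiv.permCongr
      ((Equiv.sumCongr (1 : Perm (Fin m)) δ).trans (Equiv.sumComm (Fin m) (Fin m)))) ≠ 0)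
    (hVP : IsVPFamily (k := ℂ) (fun n => ∑ σ : Perm (Fin n),
      MvPolynomial.C (χ n σ) * ∏ i : Fin n, MvPolynomial.X (σ i, i))) :
    VP ℂ = VNP ℂ :=
  isPComputable_perPoly_complex_iff.1
    (IsVPFamily.of_isPProjection_holds (isPFamily_perPoly_holds (k := ℂ))
      (isPProjection_perPoly_classGMF_two χ hχ m₀ hK) hVP).2

/-- **Under `ValiantsHypothesis`, a `VP` class-function family is 2-balanced infinitely often.**
[folklore] -/
theorem classGMF_two_balanced_io_of_valiantsHypothesis (hVH : _root_.ValiantsHypothesis)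
    (χ : (n : ℕ) → Perm (Fin n) → ℂ)
    (hχ : ∀ n (σ τ : Perm (Fin n)), IsConj σ τ → χ n σ = χ n τ)
    (hVP : IsVPFamily (k := ℂ) (fun n => ∑ σ : Perm (Fin n),
      MvPolynomial.C (χ n σ) * ∏ i : Fin n, MvPolynomial.X (σ i, i))) (m₀ : ℕ) :
    ∃ m : ℕ, m₀ ≤ m ∧ 0 < m ∧ ∑ δ : Perm (Fin m), χ (m + m) (finSumFinEquiv.permCongr
      ((Equiv.sumCongr (1 : Perm (Fin m)) δ).trans (Equiv.sumComm (Fin m) (Fin m)))) = 0 := by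
  by_contra h
  push Not at h
  exact hVH (VP_eq_VNP_of_isVPFamily_classGMF_two χ hχ m₀ (fun m h0 h1 => h m h0 h1) hVP)

/-! ## Three-fold test, family level -/

/-- **Three-fold cover test for families.**  If `χ` is a class-function family whose three-fold
balance constants `K₃(χ_{3m}) = Σ_δ χ_{3m}((k, i) ↦ (k+1, (1, 1, δ)_k i))` are nonzero for all
`m ≥ m₀`, then the permanent family is a p-projection of the GMF family of `χ`
(sizes `3 · max(m, m₀, 1)`). [folklore] -/
theorem isPProjection_perPoly_classGMF_three (χ : (n : ℕ) → Perm (Fin n) → ℂ)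
    (hχ : ∀ n (σ τ : Perm (Fin n)), IsConj σ τ → χ n σ = χ n τ) (m₀ : ℕ)
    (hK : ∀ m : ℕ, m₀ ≤ m → 0 < m → ∑ δ : Perm (Fin m), χ (3 * m) (finProdFinEquiv.permCongr
      ((Equiv.prodCongrRight ![(1 : Perm (Fin m)), 1, δ]).trans
        (Equiv.prodCongrLeft fun _ : Fin m => Equiv.addRight (1 : Fin 3)))) ≠ 0) :
    IsPProjection (fun m => perPoly (Fin m) ℂ)
      (fun n => ∑ σ : Perm (Fin n),
        MvPolynomial.C (χ n σ) * ∏ i : Fin n, MvPolynomial.X (σ i, i)) := by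
  refine ⟨fun m => 3 * max m (max m₀ 1),
    (IsPBounded.iff_exists_le_mul_succ_pow _).2 ⟨3 * m₀ + 3, 1, fun n => ?_⟩, fun m => ?_⟩
  · have h1 : max n (max m₀ 1) ≤ n + m₀ + 1 := by omega
    have h2 : (3 * m₀ + 3) * (n + 1) ^ 1 = 3 * (m₀ * n) + 3 * m₀ + 3 * n + 3 := by ring
    omega
  dsimp only
  set M := max m (max m₀ 1) with hM
  have hmM : m ≤ M := le_max_left _ _
  have hM0 : m₀ ≤ M := (le_max_left _ _).trans (le_max_right _ _)
  have hM1 : 0 < M := Nat.lt_of_lt_of_le Nat.one_pos ((le_max_right _ _).trans (le_max_right _ _))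
  exact IsProjection.trans_holds (isProjection_perPoly_of_le ℂ hmM)
    (isProjection_perPoly_classGMF_three M hM1 (χ (3 * M)) (hχ _) (hK M hM0 hM1))

/-- **`K₃ ≠ 0` eventually and GMF family in `VP` force `VP = VNP`.** [folklore] -/
theorem VP_eq_VNP_of_isVPFamily_classGMF_three (χ : (n : ℕ) → Perm (Fin n) → ℂ)
    (hχ : ∀ n (σ τ : Perm (Fin n)), IsConj σ τ → χ n σ = χ n τ) (m₀ : ℕ)
    (hK : ∀ m : ℕ, m₀ ≤ m → 0 < m → ∑ δ : Perm (Fin m), χ (3 * m) (finProdFinEquiv.permCongr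
      ((Equiv.prodCongrRight ![(1 : Perm (Fin m)), 1, δ]).trans
        (Equiv.prodCongrLeft fun _ : Fin m => Equiv.addRight (1 : Fin 3)))) ≠ 0)
    (hVP : IsVPFamily (k := ℂ) (fun n => ∑ σ : Perm (Fin n),
      MvPolynomial.C (χ n σ) * ∏ i : Fin n, MvPolynomial.X (σ i, i))) :
    VP ℂ = VNP ℂ :=
  isPComputable_perPoly_complex_iff.1
    (IsVPFamily.of_isPProjection_holds (isPFamily_perPoly_holds (k := ℂ))
      (isPProjection_perPoly_classGMF_three χ hχ m₀ hK) hVP).2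

/-- **Under `ValiantsHypothesis`, a `VP` class-function family is 3-balanced infinitely often.**
[folklore] -/
theorem classGMF_three_balanced_io_of_valiantsHypothesis (hVH : _root_.ValiantsHypothesis)
    (χ : (n : ℕ) → Perm (Fin n) → ℂ)
    (hχ : ∀ n (σ τ : Perm (Fin n)), IsConj σ τ → χ n σ = χ n τ)
    (hVP : IsVPFamily (k := ℂ) (fun n => ∑ σ : Perm (Fin n),
      MvPolynomial.C (χ n σ) * ∏ i : Fin n, MvPolynomial.X (σ i, i))) (m₀ : ℕ) :
    ∃ m : ℕ, m₀ ≤ m ∧ 0 < m ∧ ∑ δ : Perm (Fin m), χ (3 * m) (finProdFinEquiv.permCongr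
      ((Equiv.prodCongrRight ![(1 : Perm (Fin m)), 1, δ]).trans
        (Equiv.prodCongrLeft fun _ : Fin m => Equiv.addRight (1 : Fin 3)))) = 0 := by
  by_contra h
  push Not at h
  exact hVH (VP_eq_VNP_of_isVPFamily_classGMF_three χ hχ m₀ (fun m h0 h1 => h m h0 h1) hVP)

/-! ## The odd-cycle cover polynomial is permanent-hard -/

/-- Odd order is a conjugacy invariant. [folklore] -/
theorem oddOrder_conj_iff {G : Type*} [Group G] (c σ : G) :
    (∃ k : ℕ, (c * σ * c⁻¹) ^ (2 * k + 1) = 1) ↔ ∃ k : ℕ, σ ^ (2 * k + 1) = 1 := by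
  refine exists_congr fun k => ?_
  rw [conj_pow]
  constructor
  · intro h
    have h' : c⁻¹ * (c * σ ^ (2 * k + 1) * c⁻¹) * c = c⁻¹ * 1 * c := by rw [h]
    simpa [mul_assoc] using h'
  · intro h
    simp [h]

/-- Odd order is invariant under relabelling the points. [folklore] -/
theorem oddOrder_permCongr_iff {α β : Type*} (e : α ≃ β) (σ : Perm α) :
    (∃ k : ℕ, (e.permCongr σ) ^ (2 * k + 1) = 1) ↔ ∃ k : ℕ, σ ^ (2 * k + 1) = 1 := by
  refine exists_congr fun k => ?_
  rw [← Equiv.permCongrHom_coe_equiv]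
  change (e.permCongrHom σ) ^ (2 * k + 1) = 1 ↔ _
  rw [← map_pow, MulEquiv.map_eq_one_iff]

/-- **The three-fold lift `3·δ` (block maps `(1, 1, δ)`) has odd order iff `δ` has.**  (Its
order is three times that of `δ`: the block coordinate advances by one per step, and the cube
is block-diagonal with blocks conjugate to `δ`.) [folklore] -/
theorem oddOrder_blockCyclic_three_iff {ι : Type*} (i₀ : ι) (δ : Perm ι) :
    (∃ k : ℕ, ((Equiv.prodCongrRight ![(1 : Perm ι), 1, δ]).trans
        (Equiv.prodCongrLeft fun _ : ι => Equiv.addRight (1 : Fin 3))) ^ (2 * k + 1) = 1) ↔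
      ∃ k : ℕ, δ ^ (2 * k + 1) = 1 := by
  set α : Fin 3 → Perm ι := ![(1 : Perm ι), 1, δ] with hα
  have hcomp : ∀ kk : Fin 3, α (kk + 2) * α (kk + 1) * α kk = δ := by
    intro kk
    fin_cases kk <;> simp [hα]
  constructor
  · rintro ⟨k, hk⟩
    -- the block coordinate forces `3 ∣ 2k + 1`
    have hfst := blockCyclic_pow_fst α (2 * k + 1) ((0 : Fin 3), i₀)
    rw [hk, Perm.one_apply] at hfst
    have h3 : (3 : ℕ) ∣ (2 * k + 1) := by
      have h0 : ((2 * k + 1 : ℕ) : Fin 3) = 0 := by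
        have := hfst.symm
        simpa using this
      exact (Fin.natCast_eq_zero).1 h0
    obtain ⟨j, hj⟩ := h3
    -- `j` is odd, and `δ ^ j = 1` from the cube formula on block `0`
    refine ⟨j / 2, ?_⟩
    have hjodd : 2 * (j / 2) + 1 = j := by omega
    rw [hjodd]
    ext i
    have hcube := blockCyclic_three_pow_three_mul α 0 i j
    rw [← hj, hk, Perm.one_apply, hcomp 0] at hcube
    have := congrArg Prod.snd hcube
    simpa using this.symm
  · rintro ⟨k, hk⟩
    refine ⟨3 * k + 1, ?_⟩
    rw [show 2 * (3 * k + 1) + 1 = 3 * (2 * k + 1) by ring]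
    have h0 : ((3 * (2 * k + 1) : ℕ) : Fin 3) = 0 := Fin.natCast_eq_zero.2 ⟨_, rfl⟩
    refine Equiv.ext fun x => Prod.ext ?_ ?_
    · rw [blockCyclic_pow_fst α, h0, add_zero, Perm.one_apply]
    · obtain ⟨kk, i⟩ := x
      rw [blockCyclic_three_pow_three_mul α kk i, hcomp kk, hk]
      simp

open Classical in
/-- The odd-order indicator is a class function. [folklore] -/
theorem oddOrderIndicator_isClassFunction (n : ℕ) (σ τ : Perm (Fin n)) (h : IsConj σ τ) :
    (if ∃ k : ℕ, σ ^ (2 * k + 1) = 1 then (1 : ℂ) else 0) =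
      (if ∃ k : ℕ, τ ^ (2 * k + 1) = 1 then (1 : ℂ) else 0) := by
  obtain ⟨c, rfl⟩ := isConj_iff.1 h
  rw [if_congr (oddOrder_conj_iff c σ).symm rfl rfl]

open Classical in
/-- **The three-fold balance constant of the odd-order indicator is the number of odd-order
permutations of `Fin m`, hence nonzero.** [folklore] -/
theorem sum_oddOrderIndicator_blockCyclic_three_ne_zero (m : ℕ) (hm : 0 < m) :
    ∑ δ : Perm (Fin m), (if ∃ k : ℕ, (finProdFinEquiv.permCongr
        ((Equiv.prodCongrRight ![(1 : Perm (Fin m)), 1, δ]).trans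
          (Equiv.prodCongrLeft fun _ : Fin m => Equiv.addRight (1 : Fin 3)))) ^ (2 * k + 1) = 1
      then (1 : ℂ) else 0) ≠ 0 := by
  have hrw : ∀ δ : Perm (Fin m), (if ∃ k : ℕ, (finProdFinEquiv.permCongr
        ((Equiv.prodCongrRight ![(1 : Perm (Fin m)), 1, δ]).trans
          (Equiv.prodCongrLeft fun _ : Fin m => Equiv.addRight (1 : Fin 3)))) ^ (2 * k + 1) = 1
      then (1 : ℂ) else 0) = if ∃ k : ℕ, δ ^ (2 * k + 1) = 1 then (1 : ℂ) else 0 := by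
    intro δ
    exact if_congr ((oddOrder_permCongr_iff _ _).trans
      (oddOrder_blockCyclic_three_iff (⟨0, hm⟩ : Fin m) δ)) rfl rfl
  rw [Finset.sum_congr rfl fun δ _ => hrw δ, Finset.sum_boole]
  have hpos : 0 < (univ.filter fun δ : Perm (Fin m) => ∃ k : ℕ, δ ^ (2 * k + 1) = 1).card :=
    Finset.card_pos.2 ⟨1, Finset.mem_filter.2 ⟨Finset.mem_univ _, 0, by simp⟩⟩
  exact_mod_cast hpos.ne'

open Classical in
/-- **The odd-cycle cover polynomial is permanent-hard**: if the family
`O_n = Σ_{σ ∈ S_n of odd order} ∏ x_{σ(i),i}` (all cycles of odd length; `= Σ_{all cycles odd}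
sgn σ x^σ` since such `σ` are even) is in `VP`, then `VP = VNP` — the three-fold cover test with
`K₃ = #{odd-order δ ∈ S_m} ≥ 1`. [folklore] -/
theorem VP_eq_VNP_of_isVPFamily_oddOrderCover
    (hVP : IsVPFamily (k := ℂ) (fun n => ∑ σ : Perm (Fin n),
      MvPolynomial.C (if ∃ k : ℕ, σ ^ (2 * k + 1) = 1 then (1 : ℂ) else 0) *
        ∏ i : Fin n, MvPolynomial.X (σ i, i))) :
    VP ℂ = VNP ℂ :=
  VP_eq_VNP_of_isVPFamily_classGMF_three
    (fun _ σ => if ∃ k : ℕ, σ ^ (2 * k + 1) = 1 then (1 : ℂ) else 0)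
    oddOrderIndicator_isClassFunction 1
    (fun m _ hm => sum_oddOrderIndicator_blockCyclic_three_ne_zero m hm) hVP

open Classical in
/-- Under Valiant's hypothesis the odd-cycle cover family is not in `VP`. [folklore] -/
theorem not_isVPFamily_oddOrderCover_of_valiantsHypothesis (hVH : _root_.ValiantsHypothesis) :
    ¬ IsVPFamily (k := ℂ) (fun n => ∑ σ : Perm (Fin n),
      MvPolynomial.C (if ∃ k : ℕ, σ ^ (2 * k + 1) = 1 then (1 : ℂ) else 0) *
        ∏ i : Fin n, MvPolynomial.X (σ i, i)) :=
  fun hVP => hVH (VP_eq_VNP_of_isVPFamily_oddOrderCover hVP)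

/-! ## The signed involution sum (multivariate matching polynomial) is permanent-hard -/

/-- The two-fold lift `2·δ` (`inl i ↦ inr i`, `inr j ↦ inl (δ j)`) is an involution iff `δ = 1`
(its square is `inl i ↦ inl (δ i)`, `inr j ↦ inr (δ j)`). [folklore] -/
theorem blockAntidiag_one_mul_self_eq_one_iff {ι : Type*} (δ : Perm ι) :
    ((Equiv.sumCongr (1 : Perm ι) δ).trans (Equiv.sumComm ι ι)) *
        ((Equiv.sumCongr (1 : Perm ι) δ).trans (Equiv.sumComm ι ι)) = 1 ↔ δ = 1 := by
  constructor
  · intro h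
    ext i
    have := Equiv.congr_fun h (Sum.inl i)
    simpa [Perm.mul_apply] using this
  · rintro rfl
    ext x
    rcases x with i | j <;> simp [Perm.mul_apply]

/-- The signed involution indicator `sgn σ · [σ² = 1]` is a class function. [folklore] -/
theorem signedInvolutionIndicator_isClassFunction (n : ℕ) (σ τ : Perm (Fin n))
    (h : IsConj σ τ) :
    ((Perm.sign σ : ℤ) : ℂ) * (if σ * σ = 1 then (1 : ℂ) else 0) =
      ((Perm.sign τ : ℤ) : ℂ) * (if τ * τ = 1 then (1 : ℂ) else 0) := by
  obtain ⟨c, rfl⟩ := isConj_iff.1 h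
  have hsq : c * σ * c⁻¹ * (c * σ * c⁻¹) = c * (σ * σ) * c⁻¹ := by group
  have hsign : Perm.sign (c * σ * c⁻¹) = Perm.sign σ := by
    rw [Perm.sign_mul, Perm.sign_mul, Perm.sign_inv, mul_right_comm, Int.units_mul_self, one_mul]
  rw [hsign, hsq, if_congr conj_eq_one_iff rfl rfl]

/-- **The two-fold balance constant of the signed involution indicator is `sgn(2·1) = ±1 ≠ 0`.**
[folklore] -/
theorem sum_signedInvolutionIndicator_blockAntidiag_ne_zero (m : ℕ) :
    ∑ δ : Perm (Fin m), ((Perm.sign (finSumFinEquiv.permCongr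
        ((Equiv.sumCongr (1 : Perm (Fin m)) δ).trans (Equiv.sumComm (Fin m) (Fin m)))) : ℤ) : ℂ) *
      (if (finSumFinEquiv.permCongr
            ((Equiv.sumCongr (1 : Perm (Fin m)) δ).trans (Equiv.sumComm (Fin m) (Fin m)))) *
          (finSumFinEquiv.permCongr
            ((Equiv.sumCongr (1 : Perm (Fin m)) δ).trans (Equiv.sumComm (Fin m) (Fin m)))) = 1
        then (1 : ℂ) else 0) ≠ 0 := by
  set e : Fin m ⊕ Fin m ≃ Fin (m + m) := finSumFinEquiv with he
  have hiff : ∀ δ : Perm (Fin m),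
      (e.permCongr ((Equiv.sumCongr (1 : Perm (Fin m)) δ).trans (Equiv.sumComm (Fin m) (Fin m)))) *
        (e.permCongr ((Equiv.sumCongr (1 : Perm (Fin m)) δ).trans (Equiv.sumComm (Fin m) (Fin m))))
        = 1 ↔ δ = 1 := by
    intro δ
    rw [← Equiv.permCongrHom_coe_equiv]
    change e.permCongrHom _ * e.permCongrHom _ = 1 ↔ _
    rw [← map_mul, MulEquiv.map_eq_one_iff, blockAntidiag_one_mul_self_eq_one_iff]
  simp_rw [if_congr (hiff _) rfl rfl, mul_ite, mul_one, mul_zero, Finset.sum_ite_eq', Finset.mem_univ,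
    if_true]
  exact Int.cast_ne_zero.2 (Units.ne_zero _)

/-- **The signed involution sum is permanent-hard**: if the family
`I_n = Σ_{σ ∈ S_n, σ² = 1} sgn(σ) ∏ x_{σ(i),i}` — the multivariate matching polynomial
`Σ_M (-1)^{|M|} ∏_{ij ∈ M} x_ij x_ji ∏_{v ∉ V(M)} x_vv` of the complete graph — is in `VP`, then
`VP = VNP` (two-fold cover test, `K₂ = sgn(2·1) = ±1`). [folklore] -/
theorem VP_eq_VNP_of_isVPFamily_signedInvolutionSum
    (hVP : IsVPFamily (k := ℂ) (fun n => ∑ σ : Perm (Fin n),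
      MvPolynomial.C (((Perm.sign σ : ℤ) : ℂ) * (if σ * σ = 1 then (1 : ℂ) else 0)) *
        ∏ i : Fin n, MvPolynomial.X (σ i, i))) :
    VP ℂ = VNP ℂ :=
  VP_eq_VNP_of_isVPFamily_classGMF_two
    (fun _ σ => ((Perm.sign σ : ℤ) : ℂ) * (if σ * σ = 1 then (1 : ℂ) else 0))
    signedInvolutionIndicator_isClassFunction 1
    (fun m _ _ => sum_signedInvolutionIndicator_blockAntidiag_ne_zero m) hVP

/-- Under Valiant's hypothesis the signed involution sum (matching polynomial) family is not in
`VP`. [folklore] -/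
theorem not_isVPFamily_signedInvolutionSum_of_valiantsHypothesis (hVH : _root_.ValiantsHypothesis) :
    ¬ IsVPFamily (k := ℂ) (fun n => ∑ σ : Perm (Fin n),
      MvPolynomial.C (((Perm.sign σ : ℤ) : ℂ) * (if σ * σ = 1 then (1 : ℂ) else 0)) *
        ∏ i : Fin n, MvPolynomial.X (σ i, i)) :=
  fun hVP => hVH (VP_eq_VNP_of_isVPFamily_signedInvolutionSum hVP)

end Summit.ValiantsHypothesis.ValiantsHypothesis.Theorems.ClassTransfer.Negative
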